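import Mathlib
import Literature.NumberTheory.LFunctions.Zhang2022.SkeletonPartOneB
import Literature.NumberTheory.LFunctions.Zhang2022.SkeletonAssembly
import Literature.NumberTheory.LFunctions.Zhang2022.Section5Lemma59
import Literature.NumberTheory.LFunctions.Zhang2022.Section5Lemma59DedPrelims
import HarnessLib

/-!
# Zhang (2022) §5, Lemma 5.9 — the deduction "Proposition 2.2 ⇒ Lemma 5.9" kernel-checked on the
# height range Proposition 2.2 actually covers (`|t − 2πt₀| ≤ 𝓛₁ + 1/4`)

Topic `Literature/NumberTheory/LFunctions/Zhang2022` (Landau–Siegel audit tree; verdict-neutral;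
D-0069 campaign nodes **Z22:Lem5.9** / **Z22:Lem5.9.pf**, locator [Z22 p.29–30, §5 Lemma 5.9 and
(5.16), tex L1630–L1664]; cone leaf `h59` of `Skeleton.theorem1_of_leaves`).
Y. Zhang, *Discrete mean estimates and the Landau–Siegel zero*, arXiv:2211.02515v1 (2022)
[Zhang2022LandauSiegel] — **an unrefereed manuscript under adjudication**. The printed claim:

> **Lemma 5.9.** Suppose `ψ ∈ Ψ₁`, `|σ − 1/2| ≤ α`, `|t − 2πt₀| ≤ 𝓛₁ + 10` and `|s − ρ| ≫ α` for any
> zero `ρ` of `L(s,ψ)`. Then `L(s+β₁,ψ)/L(s,ψ) ≪ log P`.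
> *Proof.* It is known that `L′/L(s′,ψ) = Σ_{|ρ−s′|<1} 1/(s′−ρ) + O(1/α)` (5.16) […]. We can assume
> `L(s+β₁,ψ) ≠ 0`. Suppose `σ ≥ 1/2`. By (5.16), […]. By (5.16) and the condition `|s−ρ| ≫ α` […].
> Further, by (5.16) and **Proposition 2.2 (iii)**, `|L′/L(1/2+α+it′,ψ)| < α⁻¹Σ_{k<1/α} 1/k + O(1/α)`
> […]. Combining these estimates we obtain the result. In the case `σ < 1/2` the proof is analogous.

**What this file establishes (theorems only, no new definition, no named fact).**

* `Skeleton.lemma59_restricted_of_prop22` — for every `c′ ≥ 0`, **Proposition 2.2 (the node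
  `Skeleton.Prop22 c′`) implies Lemma 5.9 with `β₁ = iα(1−5c′α𝓛)` ON THE HEIGHT RANGE
  `|t − 2πt₀| ≤ 𝓛₁ + 1/4`** (statement otherwise verbatim `Skeleton.Lemma59 c′`: every `c₀ > 0`
  standing for the implied constant of "`≫`" gets its `C`). Ingredients, all tree theorems: the
  integrated partial fraction (5.16) = F-18 (Montgomery–Vaughan Lemma 12.1 in disc form,
  `DirichletDisc.exists_norm_logDeriv_sub_sum_le`) in the assembled form
  `Lemma59.norm_le_of_prop22` of `Section5Lemma59` (the three displays of the printed proof in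
  integrated form, zero sum `Section5Lemma59ZeroSum`); Proposition 2.2 (i) zeros on the line,
  (ii) simple (so the Jensen-disc divisor weights are `1`), (iii) consecutive gaps `> α − c′α²𝓛`
  (made into pairwise separation via finiteness of the zero set of `L(s,ψ)L(s,ψχ)` in `Ω`,
  identity principle); the case `σ = 1/2` (segment `[s, s+β₁]` possibly through a zero ordinate) by
  continuity from `σ = 1/2 + δ`, `δ → 0⁺`.
* `Skeleton.lemma59A_restricted_of_prop22` — the same in the print-faithful (A)-form of
  `Skeleton.Lemma59A c′` (`SkeletonBlanketA`; the (A) antecedent is not used);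
* `Skeleton.lemma59_restricted_of_lemma59` — the restricted statement is (trivially) implied by the
  typed node `Skeleton.Lemma59 c′` (range `𝓛₁ + 10`): it is a WEAKENING, recorded as such.

**Why the restriction (campaign GAP-LEDGER row G-d14-1).** Proposition 2.2 speaks about the zeros
of `L(s,ψ)L(s,ψχ)` in `Ω = {|σ − 1/2| < 1/2, |t − 2πt₀| < 𝓛₁ + 2}` (2.7); the printed proof of
Lemma 5.9 invokes Proposition 2.2 (iii) at heights up to `𝓛₁ + 10 + α`, where no typed statement
of the manuscript controls the zeros — so `Prop22 c′ → Lemma59 c′` AS TYPED (`𝓛₁ + 10`) is not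
derivable from the typed interfaces, while the three use sites of Lemma 5.9 (tex L2196–L2201 on the
rectangle `𝔯` of heights `≤ 𝓛₁ + O(α)`, L2240, L3806/L3817) lie inside `|t − 2πt₀| ≤ 𝓛₁ + 1/4`.
With `|t − 2πt₀| ≤ 𝓛₁ + 1/4` every zero of the Jensen disc `|ρ − (2+it)| ≤ 81/50` lies in `Ω`
(`|Im ρ − 2πt₀| ≤ 𝓛₁ + 1/4 + 81/50 < 𝓛₁ + 2`, `19/50 ≤ Re ρ < 1`). Typed ≠ proved; a gap row is
not a refutation. WHAT THIS IS NOT: any statement about Theorems 1–2 of the manuscript or about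
Landau–Siegel zeros; `Prop22` stays a CLAIM node (hypothesis here).

## References

* Y. Zhang, arXiv:2211.02515v1 (2022), §5 Lemma 5.9, (5.16); §2 (2.7), (2.10), (2.13),
  Proposition 2.2; §8 p. 47 (use on `𝔯`). [cite: Zhang2022LandauSiegel, §5 Lemma 5.9]
* H. L. Montgomery, R. C. Vaughan, *Multiplicative Number Theory I*, CUP 2007, Lemma 12.1
  (through the tree's `DirichletLogDerivDisc.lean`). [cite: MontgomeryVaughan2007, Lemma 12.1]
-/

noncomputable section

open Complex Real Set Metric Filter _root_.Topology Finset

namespace Literature.NumberTheory.LFunctions.Zhang2022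

namespace Lemma59Ded

/-! ### Elementary devices for the assembly (continuity at `σ = 1/2`, scales, distances) -/

/-- **The case `σ = 1/2` by continuity**: if a continuous `F : ℂ → ℂ` satisfies
`‖F(1/2+δ+it+iv)‖ ≤ ‖F(1/2+δ+it)‖·M` for all `δ ∈ (0, δ₀)`, then also at `δ = 0` (the case
`σ = 1/2` of Lemma 5.9). [cite: Zhang2022LandauSiegel, §5 Lemma 5.9 (proof)] -/
theorem norm_le_at_half_of_right {F : ℂ → ℂ} (hF : Continuous F) {t v M δ₀ : ℝ}
    (hδ₀ : 0 < δ₀)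
    (h : ∀ δ ∈ Set.Ioo (0 : ℝ) δ₀,
      ‖F (((1 / 2 + δ : ℝ) : ℂ) + t * I + v * I)‖ ≤ ‖F (((1 / 2 + δ : ℝ) : ℂ) + t * I)‖ * M) :
    ‖F (((1 / 2 : ℝ) : ℂ) + t * I + v * I)‖ ≤ ‖F (((1 / 2 : ℝ) : ℂ) + t * I)‖ * M := by
  have hlin : Continuous fun δ : ℝ => (((1 / 2 + δ : ℝ) : ℂ) + (t : ℂ) * I) := by fun_prop
  have hlin' : Continuous fun δ : ℝ => (((1 / 2 + δ : ℝ) : ℂ) + (t : ℂ) * I + (v : ℂ) * I) := by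
    fun_prop
  have hf_cont : Continuous fun δ : ℝ => ‖F (((1 / 2 + δ : ℝ) : ℂ) + (t : ℂ) * I + (v : ℂ) * I)‖ :=
    (hF.comp hlin').norm
  have hg_cont : Continuous fun δ : ℝ => ‖F (((1 / 2 + δ : ℝ) : ℂ) + (t : ℂ) * I)‖ * M :=
    (hF.comp hlin).norm.mul continuous_const
  have hev : (fun δ : ℝ => ‖F (((1 / 2 + δ : ℝ) : ℂ) + (t : ℂ) * I + (v : ℂ) * I)‖)
      ≤ᶠ[𝓝[>] (0 : ℝ)] (fun δ : ℝ => ‖F (((1 / 2 + δ : ℝ) : ℂ) + (t : ℂ) * I)‖ * M) := by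
    filter_upwards [Ioo_mem_nhdsGT hδ₀] with δ hδ using h δ hδ
  have hlim := le_of_tendsto_of_tendsto (tendsto_nhdsWithin_of_tendsto_nhds (hf_cont.tendsto 0))
    (tendsto_nhdsWithin_of_tendsto_nhds (hg_cont.tendsto 0)) hev
  simpa only [add_zero] using hlim

/-- The final numerical step: with `ℒ ≤ 3𝓛⁹`, `v₁ ≤ α = π/𝓛⁹` and the zero-sum terms
`B ≤ B_κ + log(1/α)`, `exp(Cℒv₁ + B) ≤ (e^{3πC + B_κ}/π)·𝓛⁹` ("Combining these estimates we
obtain the result", Lemma 5.9). [cite: Zhang2022LandauSiegel, §5 Lemma 5.9 (proof)] -/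
theorem exp_bound_le {C ℒ v₁ α B Bκ L : ℝ} (hC : 0 ≤ C) (hL0 : 0 < L)
    (hα : α = Real.pi / L ^ 9) (hℒ : ℒ ≤ 3 * L ^ 9) (hv0 : 0 ≤ v₁) (hvα : v₁ ≤ α)
    (hB : B ≤ Bκ + Real.log (1 / α)) :
    Real.exp (C * ℒ * v₁ + B) ≤ Real.exp (3 * Real.pi * C + Bκ) / Real.pi * L ^ 9 := by
  have hα0 : 0 < α := by rw [hα]; positivity
  have h1 : C * ℒ * v₁ ≤ 3 * Real.pi * C := by
    calc C * ℒ * v₁ ≤ C * (3 * L ^ 9) * α := by gcongr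
      _ = 3 * Real.pi * C := by rw [hα]; field_simp
  have hle : C * ℒ * v₁ + B ≤ (3 * Real.pi * C + Bκ) + Real.log (1 / α) := by linarith
  refine (Real.exp_le_exp.mpr hle).trans (le_of_eq ?_)
  rw [Real.exp_add, Real.exp_log (by positivity), hα]
  field_simp

/-- The scales: for `𝓛 ≥ 32 + 40c′` (`c′ ≥ 0`) and `α = π/𝓛⁹`: `0 < α ≤ 1/100` and `c′α𝓛 ≤ 1/10`.
[cite: Zhang2022LandauSiegel, §2 (2.10)] -/
theorem scales {c' α L : ℝ} (hc' : 0 ≤ c') (hL : 32 + 40 * c' ≤ L)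
    (hα : α = Real.pi / L ^ 9) : 0 < α ∧ α ≤ 1 / 100 ∧ c' * α * L ≤ 1 / 10 := by
  have hL32 : 32 ≤ L := by linarith
  have hL1 : 1 ≤ L := by linarith
  have hL0 : 0 < L := by linarith
  refine ⟨by rw [hα]; positivity, ?_, ?_⟩
  · rw [hα, div_le_iff₀ (by positivity)]
    have : (32 : ℝ) ^ 9 ≤ L ^ 9 := pow_le_pow_left₀ (by norm_num) hL32 9
    nlinarith [Real.pi_lt_four]
  · have hL8 : 40 * c' ≤ L ^ 8 := by
      calc 40 * c' ≤ L := by linarith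
        _ = L ^ 1 := (pow_one _).symm
        _ ≤ L ^ 8 := pow_le_pow_right₀ hL1 (by norm_num)
    have e : c' * α * L = c' * Real.pi / L ^ 8 := by
      rw [hα]; field_simp
    rw [e, div_le_iff₀ (by positivity)]
    nlinarith [Real.pi_lt_four, Real.pi_pos]

/-- The shifts: with `x = c′α𝓛 ∈ [0, 1/10]`, `v₁ = α(1 − 5x)` and `g = α − c′α²𝓛 = α(1 − x)` satisfy
`0 < v₁ ≤ α`, `v₁ ≤ g`, `α/2 ≤ g`. [cite: Zhang2022LandauSiegel, §2 (2.13)] -/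
theorem shifts {c' α L : ℝ} (hc' : 0 ≤ c') (hα0 : 0 < α) (hL0 : 0 ≤ L)
    (hcαL : c' * α * L ≤ 1 / 10) :
    0 < α * (1 - 5 * c' * α * L) ∧ α * (1 - 5 * c' * α * L) ≤ α ∧
      α * (1 - 5 * c' * α * L) ≤ α - c' * α ^ 2 * L ∧ α / 2 ≤ α - c' * α ^ 2 * L := by
  have hx0 : 0 ≤ c' * α * L := by positivity
  have e : α - c' * α ^ 2 * L = α * (1 - c' * α * L) := by ring
  rw [e]
  refine ⟨by nlinarith, by nlinarith, by nlinarith, by nlinarith⟩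

/-- Distance bookkeeping: if `|s − ρ| ≥ c₀α`, `|σ′ − Re s| ≤ κα` and `2κ ≤ c₀`, then
`|σ′ + i·Im s − ρ| ≥ κα` (the hypothesis "`|s − ρ| ≫ α`" of Lemma 5.9 moved to a nearby
abscissa). [cite: Zhang2022LandauSiegel, §5 Lemma 5.9] -/
theorem dist_ge {s ρ : ℂ} {σ' c₀ κ α : ℝ} (hα : 0 ≤ α) (hκc₀ : 2 * κ ≤ c₀)
    (hfar : c₀ * α ≤ ‖s - ρ‖) (hσ' : |σ' - s.re| ≤ κ * α) :
    κ * α ≤ ‖(σ' : ℂ) + (s.im : ℂ) * I - ρ‖ := by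
  have hsσ : ‖s - ((σ' : ℂ) + (s.im : ℂ) * I)‖ = |σ' - s.re| := by
    have e : s - ((σ' : ℂ) + (s.im : ℂ) * I) = ((s.re - σ' : ℝ) : ℂ) := by
      apply Complex.ext <;> simp
    rw [e, Complex.norm_real, Real.norm_eq_abs, abs_sub_comm]
  have htri : ‖s - ρ‖ ≤ ‖s - ((σ' : ℂ) + (s.im : ℂ) * I)‖ + ‖(σ' : ℂ) + (s.im : ℂ) * I - ρ‖ :=
    norm_sub_le_norm_sub_add_norm_sub s ((σ' : ℂ) + (s.im : ℂ) * I) ρ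
  rw [hsσ] at htri
  have h2 : 2 * κ * α ≤ c₀ * α := mul_le_mul_of_nonneg_right hκc₀ hα
  linarith

end Lemma59Ded

namespace Skeleton

open Lemma59Ded Literature.NumberTheory.LFunctions.DirichletDisc

/-- **Lemma 5.9 ⇐ Proposition 2.2, on the height range `|t − 2πt₀| ≤ 𝓛₁ + 1/4`** (DAG
`Z22:Lem5.9.pf`; printed proof [Z22 p.30, tex L1636–L1664] with (5.16) = F-18 = tree MV Lemma 12.1
in the integrated form `Lemma59.norm_le_of_prop22`): for every `c′ ≥ 0` (the constant of (2.13)),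
if `Skeleton.Prop22 c′` holds then for every `c₀ > 0` there is `C` such that for all large `D`,
every real primitive `χ (mod D)`, every `ψ ∈ Ψ₁`, and every `s = σ + it` with `|σ − 1/2| ≤ α`,
`|t − 2πt₀| ≤ 𝓛₁ + 1/4` and `|s − ρ| ≥ c₀α` for all zeros `ρ` of `L(·,ψ)`:
`‖L(s+β₁,ψ)/L(s,ψ)‖ ≤ C log P`. The conclusion is `Skeleton.Lemma59 c′` with the printed height
bound `𝓛₁ + 10` replaced by `𝓛₁ + 1/4` — the range on which Proposition 2.2 (about `Ω`, height
`< 𝓛₁ + 2`) controls the zeros of the Jensen disc; see the module docstring and GAP-LEDGER G-d14-1.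
[cite: Zhang2022LandauSiegel, §5 Lemma 5.9] -/
theorem lemma59_restricted_of_prop22 {c' : ℝ} (hc' : 0 ≤ c') (h22 : Prop22 c') :
    ∀ c₀ : ℝ, 0 < c₀ → ∃ C : ℝ, ForAllLarge fun D _ χ => ∀ x ∈ PsiOne χ, ∀ s : ℂ,
      |s.re - 1 / 2| ≤ alpha D → |s.im - 2 * π * t0 D| ≤ ell1 D + 1 / 4 →
        (∀ ρ : ℂ, x.ψ.LFunction ρ = 0 → c₀ * alpha D ≤ ‖s - ρ‖) →
          ‖x.ψ.LFunction (s + beta1 c' D) / x.ψ.LFunction s‖ ≤ C * Real.log (bigP D) := by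
  intro c₀ hc₀
  obtain ⟨h22i, h22ii, h22iii⟩ := h22
  obtain ⟨C, hC0, hC⟩ := Lemma59.norm_le_of_prop22
  -- the scale-free constants
  set κ : ℝ := min c₀ 1 / 2 with hκdef
  have hκ0 : 0 < κ := by rw [hκdef]; positivity
  have hκ : κ ≤ 1 / 2 := by
    rw [hκdef]; linarith [min_le_right c₀ 1]
  have hκc₀ : 2 * κ ≤ c₀ := by rw [hκdef]; linarith [min_le_left c₀ 1]
  set Bκ : ℝ := 3 / 2 * Real.log (4 / κ ^ 2) + 2 / κ + Real.log (2 / κ) + 1 / κ ^ 2 with hBκ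
  set K : ℝ := Real.exp (3 * Real.pi * C + Bκ) / Real.pi with hKdef
  refine ⟨K, ?_⟩
  -- thresholds: Proposition 2.2's `D₀`, and `𝓛 ≥ 32 + 40c′`
  obtain ⟨D₁, hD₁⟩ := (h22i.and h22ii).and h22iii
  refine ⟨max D₁ ⌈Real.exp (32 + 40 * c')⌉₊, fun D _ χ hD hq hp x hx s hσ ht hfar => ?_⟩
  obtain ⟨⟨hi, hii⟩, hiii⟩ := hD₁ D χ (le_trans (le_max_left _ _) hD) hq hp
  have hDceil : ⌈Real.exp (32 + 40 * c')⌉₊ ≤ D := le_trans (le_max_right _ _) hD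
  have hexp : Real.exp (32 + 40 * c') ≤ D := le_trans (Nat.le_ceil _) (by exact_mod_cast hDceil)
  have hD0 : (0 : ℝ) < D := lt_of_lt_of_le (Real.exp_pos _) hexp
  have hLc : 32 + 40 * c' ≤ ell D := (Real.le_log_iff_exp_le hD0).mpr hexp
  have hL : 32 ≤ ell D := by linarith
  have hL1 : 1 ≤ ell D := by linarith
  have hL0 : 0 < ell D := by linarith
  have hD3 : 3 ≤ D := by
    have h3 : (3 : ℝ) ≤ Real.exp (32 + 40 * c') := by
      have := Real.add_one_le_exp (32 + 40 * c'); linarith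
    exact_mod_cast h3.trans hexp
  -- the scales `α = π/𝓛⁹`, `v₁ = α(1 − 5c′α𝓛)`, `g = α − c′α²𝓛`
  have hlogP : Real.log (bigP D) = ell D ^ 9 := by rw [bigP, Real.log_exp]
  have hα : alpha D = Real.pi / ell D ^ 9 := by rw [alpha, hlogP]
  obtain ⟨hα0, hα100, hcαL⟩ := scales hc' hLc hα
  obtain ⟨hv₁0, hv₁α, hv₁g, hgα⟩ := shifts hc' hα0 hL0.le hcαL
  set v₁ : ℝ := alpha D * (1 - 5 * c' * alpha D * ell D) with hv₁def
  set g : ℝ := alpha D - c' * alpha D ^ 2 * ell D with hgdef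
  have hg0 : 0 < g := by linarith
  have hv₁100 : v₁ ≤ 1 / 100 := hv₁α.trans hα100
  have hβ₁ : beta1 c' D = (v₁ : ℂ) * I := by
    rw [beta1, hv₁def]; push_cast; ring
  -- the zero data at height `t = Im s`: on the line, simple, `g`-separated
  set t : ℝ := s.im with htdef
  have hψ1 : x.ψ ≠ 1 := x.ψ_ne_one
  have hfin := prodZeroSetOmega_finite χ x hD3 hp
  have hZΩ : ∀ ρ ∈ discZeros x.ψ t, ρ ∈ prodZeroSetOmega χ x := fun ρ hρ =>
    mem_prodZeroSetOmega_of_mem_discZeros χ x ht hρ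
  have hline : ∀ ρ ∈ discZeros x.ψ t, ρ.re = 1 / 2 := fun ρ hρ => hi x hx ρ (hZΩ ρ hρ)
  have hsimple : ∀ ρ ∈ discZeros x.ψ t, discDivisor x.ψ t ρ = 1 := fun ρ hρ =>
    discDivisor_eq_one_of_deriv_ne_zero χ x hρ (hii x hx ρ (hZΩ ρ hρ))
  have hgap : ∀ ρ ∈ discZeros x.ψ t, ∀ ρ' ∈ discZeros x.ψ t, ρ ≠ ρ' → g ≤ |ρ.im - ρ'.im| :=
    discZeros_separated hfin (hiii x hx) hZΩ hline (by rw [hgdef])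
  -- the size of `Cℒv₁` and of the zero-sum terms: `exp(Cℒv₁ + B) ≤ K log P`
  have hℒ : Real.log x.p + Real.log (|t| + 4) ≤ 3 * ell D ^ 9 := ell_disc_le hL x ht
  have hbook := bookkeeping_le hα0 hα100 hκ0 hκ hgα hv₁0 hv₁g hv₁α
  have hexpK := exp_bound_le hC0.le hL0 hα hℒ hv₁0.le hv₁α hbook
  rw [← hlogP] at hexpK
  -- the core estimate at an abscissa `σ′ ≠ 1/2` within `κα` of `σ`
  have hcore : ∀ σ' : ℝ, |σ' - 1 / 2| ≤ alpha D → σ' ≠ 1 / 2 → |σ' - s.re| ≤ κ * alpha D →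
      ‖x.ψ.LFunction ((σ' : ℂ) + t * I + v₁ * I)‖
        ≤ ‖x.ψ.LFunction ((σ' : ℂ) + t * I)‖ * (K * Real.log (bigP D)) := by
    intro σ' hσ' hσ'ne hσ'σ
    have hσ'100 : |σ' - 1 / 2| ≤ 1 / 100 := hσ'.trans hα100
    -- zero-free segment (off the line, all disc zeros are on the line)
    have hseg : ∀ y ∈ Set.Icc (0 : ℝ) v₁, x.ψ.LFunction ((σ' : ℂ) + t * I + y * I) ≠ 0 := by
      intro y hy h0
      have hmem : (σ' : ℂ) + t * I + y * I ∈ discZeros x.ψ t :=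
        (mem_discZeros hψ1).2 ⟨mem_disc hσ'100 hy.1 (hy.2.trans hv₁100), h0⟩
      have hre := hline _ hmem
      simp only [Complex.add_re, Complex.ofReal_re, Complex.mul_re, Complex.I_re, Complex.I_im,
        Complex.ofReal_im, mul_zero, mul_one, sub_self, add_zero] at hre
      exact hσ'ne hre
    -- distance `≥ κα` from the zeros
    have hdist : ∀ ρ ∈ discZeros x.ψ t, κ * alpha D ≤ ‖(σ' : ℂ) + t * I - ρ‖ := fun ρ hρ =>
      dist_ge hα0.le hκc₀ (hfar ρ (discZeros_prop hψ1 hρ).1) hσ'σ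
    have hκα81 : κ * alpha D ≤ 81 / 50 := by
      have : κ * alpha D ≤ 1 / 2 * (1 / 100) := mul_le_mul hκ hα100 hα0.le (by norm_num)
      linarith
    have h := hC x.p x.ψ hψ1 σ' t v₁ (alpha D) g (κ * alpha D) hσ' hα100 hv₁0 hv₁100 hg0
      (by positivity) hκα81 hseg hline hsimple hgap hdist
    exact h.trans (mul_le_mul_of_nonneg_left (by rw [hKdef]; exact hexpK) (norm_nonneg _))
  -- `L(s) ≠ 0` (distance `c₀α > 0` from every zero)
  have hLs : x.ψ.LFunction s ≠ 0 := by
    intro h0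
    have := hfar s h0
    rw [sub_self, norm_zero] at this
    have := mul_pos hc₀ hα0
    linarith
  have hs_eq : s = (s.re : ℂ) + t * I := by rw [htdef]; exact (Complex.re_add_im s).symm
  -- the estimate at `s` itself: directly off the line, by continuity on the line
  have hmain : ‖x.ψ.LFunction (s + (v₁ : ℂ) * I)‖
      ≤ ‖x.ψ.LFunction s‖ * (K * Real.log (bigP D)) := by
    by_cases hσhalf : s.re = 1 / 2
    · -- `σ = 1/2`: approach from `σ′ = 1/2 + δ`, `δ → 0⁺`
      have hcont : Continuous x.ψ.LFunction :=
        (DirichletCharacter.differentiable_LFunction hψ1).continuous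
      have hδ : ∀ δ ∈ Set.Ioo (0 : ℝ) (κ * alpha D),
          ‖x.ψ.LFunction (((1 / 2 + δ : ℝ) : ℂ) + t * I + v₁ * I)‖
            ≤ ‖x.ψ.LFunction (((1 / 2 + δ : ℝ) : ℂ) + t * I)‖ * (K * Real.log (bigP D)) := by
        intro δ hδ
        have h1 : |(1 / 2 + δ) - 1 / 2| ≤ alpha D := by
          rw [show (1 : ℝ) / 2 + δ - 1 / 2 = δ by ring, abs_of_pos hδ.1]
          have : κ * alpha D ≤ alpha D := mul_le_of_le_one_left hα0.le (by linarith)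
          linarith [hδ.2]
        have h2 : (1 : ℝ) / 2 + δ ≠ 1 / 2 := by linarith [hδ.1]
        have h3 : |(1 / 2 + δ) - s.re| ≤ κ * alpha D := by
          rw [hσhalf, show (1 : ℝ) / 2 + δ - 1 / 2 = δ by ring, abs_of_pos hδ.1]; exact hδ.2.le
        exact hcore (1 / 2 + δ) h1 h2 h3
      have h := norm_le_at_half_of_right hcont (by positivity) hδ
      have e0 : (((1 / 2 : ℝ) : ℂ) + (t : ℂ) * I) = s := by
        rw [hs_eq, hσhalf]
      rwa [e0] at h
    · have h := hcore s.re hσ hσhalf (by rw [sub_self, abs_zero]; positivity)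
      rwa [← hs_eq] at h
  -- conclude
  have hK0 : 0 ≤ K * Real.log (bigP D) := by rw [hKdef, hlogP]; positivity
  rw [hβ₁, norm_div, div_le_iff₀ (norm_pos_iff.mpr hLs)]
  calc ‖x.ψ.LFunction (s + (v₁ : ℂ) * I)‖ ≤ ‖x.ψ.LFunction s‖ * (K * Real.log (bigP D)) := hmain
    _ = K * Real.log (bigP D) * ‖x.ψ.LFunction s‖ := by ring

/-- The same deduction in the PRINT-FAITHFUL (A)-form of sz-skel's `Skeleton.Lemma59A c′`
(`SkeletonBlanketA`: Lemma 5.9 stands under the blanket Assumption (A) of p. 28, tex L1560), with the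
height range `𝓛₁ + 1/4`: the (A) antecedent is simply not used. [cite: Zhang2022LandauSiegel, §5 Lemma 5.9] -/
theorem lemma59A_restricted_of_prop22 {c' : ℝ} (hc' : 0 ≤ c') (h22 : Prop22 c') :
    ∀ c₀ : ℝ, 0 < c₀ → ∃ C : ℝ, ForAllLarge fun D _ χ => AssumptionA D χ → ∀ x ∈ PsiOne χ, ∀ s : ℂ,
      |s.re - 1 / 2| ≤ alpha D → |s.im - 2 * π * t0 D| ≤ ell1 D + 1 / 4 →
        (∀ ρ : ℂ, x.ψ.LFunction ρ = 0 → c₀ * alpha D ≤ ‖s - ρ‖) →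
          ‖x.ψ.LFunction (s + beta1 c' D) / x.ψ.LFunction s‖ ≤ C * Real.log (bigP D) := by
  intro c₀ hc₀
  obtain ⟨C, D₀, h⟩ := lemma59_restricted_of_prop22 hc' h22 c₀ hc₀
  exact ⟨C, D₀, fun D _ χ hD hq hp _ x hx s hσ ht hfar => h D χ hD hq hp x hx s hσ ht hfar⟩

/-- The restricted statement is a WEAKENING of the typed node `Skeleton.Lemma59 c′` (printed height
range `|t − 2πt₀| ≤ 𝓛₁ + 10`): `Lemma59 c′` implies it (`1/4 ≤ 10`). Recorded so that the relation
between the node and what is proved here is explicit (GAP-LEDGER G-d14-1).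
[cite: Zhang2022LandauSiegel, §5 Lemma 5.9] -/
theorem lemma59_restricted_of_lemma59 {c' : ℝ} (h : Lemma59 c') :
    ∀ c₀ : ℝ, 0 < c₀ → ∃ C : ℝ, ForAllLarge fun D _ χ => ∀ x ∈ PsiOne χ, ∀ s : ℂ,
      |s.re - 1 / 2| ≤ alpha D → |s.im - 2 * π * t0 D| ≤ ell1 D + 1 / 4 →
        (∀ ρ : ℂ, x.ψ.LFunction ρ = 0 → c₀ * alpha D ≤ ‖s - ρ‖) →
          ‖x.ψ.LFunction (s + beta1 c' D) / x.ψ.LFunction s‖ ≤ C * Real.log (bigP D) := by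
  intro c₀ hc₀
  obtain ⟨C, D₀, hC⟩ := h c₀ hc₀
  exact ⟨C, D₀, fun D _ χ hD hq hp x hx s hσ ht hfar =>
    hC D χ hD hq hp x hx s hσ (ht.trans (by norm_num)) hfar⟩

end Skeleton

end Literature.NumberTheory.LFunctions.Zhang2022
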